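import Literature.IUT.HodgeArakelov.MonoThetaProjectiveProp16EllipticRef
import HarnessLib

/-!
# [IUTchII] Prop. 1.6 (ii): the GENUINE output structure — the frozen output EXTENDED by the successor predicate
# (decl-for-decl replacement of the reference stand-in `PiURef`/`projRef`)

Statement-only successor (one structure + one plumbing `def`; abc-iut cell, wave-5 seat abc-iut-w5-d030 gen 9; DAG node
**IUTchII:Prop1.6(ii)**, layer L6, OUTSIDE the [IUTchIII] Cor. 3.12 cone) of `MonoThetaProjectiveProp16EllipticRef.lean`
(the `Prop`-valued successor predicate `EllipticCuspidalization.RefIsElliptic`), written to abc-iut-L6-lead's ruling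
§F v1.19an (2026-08-26T10:29Z): "the flip needs the successor predicate to REPLACE the definitional `projRef` stand-in
decl-for-decl, frozen Prop16 files untouched". S. Mochizuki, *Inter-universal Teichmüller Theory II*, kurims
manuscript (Dec. 2020), §1, Prop. 1.6 (ii) p. 31 l. 34–41 ("`Π ↦ {Π_{U_N}(Π) ↠ Π}` … such that when `Π = Π^tp_{X̲̲_k}`,
the surjection `Π_{U_N}(Π) ↠ Π` may be naturally identified with … “elliptic cuspidalization” … determined by the
`N`-torsion points of a once-punctured elliptic curve that forms a double covering of `C_k` [cf. [AbsTopII], Corollary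
3.3, (iii)]") [claim: Mochizuki2012, status: disputed] (IUTchII §1 Prop 1.6 (ii), kurims p.31); [AbsTopII] Cor. 3.3
(iii), Rmk. 3.3.3 [cite: MochizukiAbsTopII2013, Cor 3.3 (iii) p.68]; [SemiAnbd] §6 [cite: MochizukiSemiAnbd2006, §6 pp.69-74].

* **`EllipticCuspidalization.Genuine S N P X U eX`** `extends EllipticCuspidalization S N P` — the frozen output
  (p407497: `PiU ↠ P`, `PiURef`, `projRef`, `identified`) TOGETHER WITH the identification
  `eU : Π^tp_U ≃ₜ* PiURef` of its reference side with the tempered group of the curve `U` (playing `U_X`) and the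
  proof `refIsElliptic : RefIsElliptic X U eX eU` that `projRef` IS the elliptic cuspidalisation of level `N`
  ((R0) `Π = Π^tp_{X̲̲_k}`, (R1) tempered `DLoc`-kernel reading + [AbsTopII] Cor. 3.3 (iii)(c), (R2) profinite record of
  level `N` = abc-iut-L4-t6's `AbsTopII.EllipticCuspidalization`). This is the decl-for-decl replacement: a consumer
  that took `K : EllipticCuspidalization S N P` takes `G : EllipticCuspidalization.Genuine S N P X U eX` and reads the
  same fields through `G.toEllipticCuspidalization`, now constrained.
* `EllipticCuspidalization.Genuine.transport` — functoriality along `P ≃ₜ* P'` (the reference side does not move).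

HONEST SCOPE: a STRUCTURE over interface data (`X U : SemiGraphs.TemperedCurve p`); inhabiting it at the [EtTh] model
needs `Π^tp` of the punctured curve `U_X` ([SemiAnbd] §6 interface; MERGE debt rows 92/141 unchanged) — nothing is
inhabited here; nothing takes a side on [IUTchIII] Cor. 3.12; typed ≠ proved for the series.
-/

universe u

namespace Literature.IUT.HodgeArakelov

open Literature.AnabelianGeometry.SemiGraphs (TemperedCurve)

/-- **IUTchII:Prop1.6(ii), GENUINE OUTPUT** ("Elliptic Cuspidalizations", kurims p. 31): the frozen output
`EllipticCuspidalization S N P` extended, decl-for-decl on its reference side, by the identification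
`eU : Π^tp_U ≃ₜ* PiURef` and the successor predicate `RefIsElliptic X U eX eU` — "when `Π = Π^tp_{X̲̲_k}`, the surjection
`Π_{U_N}(Π) ↠ Π` may be naturally identified with … “elliptic cuspidalization” … [cf. [AbsTopII], Corollary 3.3, (iii)]".
A structure over the tree's interfaces; never asserted to be inhabited.
[claim: Mochizuki2012, status: disputed] (IUTchII §1 Prop 1.6 (ii), kurims p.31) -/
structure EllipticCuspidalization.Genuine (S : ThetaSetting.{u}) (N : ℕ+) (P : TopGroup.{u})
    {p : ℕ} [Fact p.Prime] (X U : TemperedCurve p) (eX : X.PiTemp ≃ₜ* S.PiX)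
    extends EllipticCuspidalization S N P where
  /-- the reference side `Π^tp_{U_N}` IS the tempered fundamental group of the curve `U` (playing `U_X`) -/
  eU : U.PiTemp ≃ₜ* toEllipticCuspidalization.PiURef
  /-- the reference surjection IS the elliptic cuspidalisation of level `N` (successor predicate) -/
  refIsElliptic : toEllipticCuspidalization.RefIsElliptic X U eX eU

namespace EllipticCuspidalization.Genuine

variable {S : ThetaSetting.{u}} {N : ℕ+} {P P' : TopGroup.{u}} {p : ℕ} [Fact p.Prime] {X U : TemperedCurve p}
  {eX : X.PiTemp ≃ₜ* S.PiX}

/-- **Functoriality** of the genuine output along `P ≃ₜ* P'` ("functorial group-theoretic algorithm"): transport the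
underlying output (`EllipticCuspidalization.transport`: same `Π_{U_N}(·)`, same reference datum) and keep `eU` and
the predicate (`RefIsElliptic` is stated on the reference side, which does not move).
[claim: Mochizuki2012, status: disputed] (IUTchII §1 Prop 1.6 (ii), kurims p.31) -/
noncomputable def transport (G : EllipticCuspidalization.Genuine S N P X U eX) (f : P ≃ₜ* P') :
    EllipticCuspidalization.Genuine S N P' X U eX where
  toEllipticCuspidalization := G.toEllipticCuspidalization.transport f
  eU := G.eU
  refIsElliptic :=
    { deltaTemp_eq := G.refIsElliptic.deltaTemp_eq
      K_eq := G.refIsElliptic.K_eq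
      continuous_projRef := G.refIsElliptic.continuous_projRef
      aug_comp := G.refIsElliptic.aug_comp
      kernel_eq := G.refIsElliptic.kernel_eq
      elliptic := G.refIsElliptic.elliptic }

/-- The transport does not move the reference side. [claim: Mochizuki2012, status: disputed] (IUTchII §1 Prop 1.6 (ii), kurims p.31) -/
theorem transport_PiURef (G : EllipticCuspidalization.Genuine S N P X U eX) (f : P ≃ₜ* P') :
    (G.transport f).PiURef = G.PiURef := rfl

end EllipticCuspidalization.Genuine

end Literature.IUT.HodgeArakelov
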